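import Literature.NumberTheory.LFunctions.FeketePolyaKernelCertificatesBlockWrappers
import HarnessLib

/-!
# No real zero for real primitive characters of conductor `17453 ≤ q ≤ 18196`: the Fekete–Pólya rows, in the kernel (rows deferred by the earlier engines)

Topic `Literature/NumberTheory/LFunctions`; namespace `Literature.NumberTheory.LFunctions`. THEOREMS only (no
definition, no named fact, no `sorry`; standard axioms): one PUBLIC theorem **`noRealZero{Odd,Even}_fp_<q>`** per
fundamental discriminant `D`, `|D| = q ∈ [17453, 18196]`, that admits a Fekete–Pólya witness but was DEFERRED by the per-position engines v1/v2 (walk too long for one `decide`) — for every primitive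
quadratic `χ` mod `q` of the parity of `D` and every `σ ∈ (0, 1)`, `L(σ, χ) ≠ 0` (statement shape of the
`interval_cases` bullets of the `NoRealZero{Odd,Even}…` range files, so a range assembly cites them by name).
Cell `parity-realchar`, kernel floor of the wide column (TARGET §2 row 19), Fekete–Pólya lane (seat prover-2).

Method (engine v4): `FeketePolyaKernelCertificatesBlock{,Wrappers}.lean` — the iterated partial sums of order
`K` of the induced character `χ↑(q·w)` are non-negative over one period, decided in the kernel BLOCKWISE on packed
base-`2^b` digits (`blockCert b B K (q·w) (tabs… b ps q w)`: sign tables of the character from the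
quadratic-residue bitsets of the prime factors of the conductor — the factor list is part of each certificate,
primality by `norm_num` — prefix sums by one big-integer multiplication per order and block, sign test by one
AND), hence `ℜL(σ, χ↑(q·w)) > 0` (Fekete–Pólya 1912 / MV §11.2.1 Exercise 7) and `L(σ, χ) ≠ 0` (positive Euler
factors, Exercise 8).  Witnesses `(w, K)` = the cheapest in the exact integer scan of this seat
(`HOME/parity-realchar-prover-2/fp-witnesses-*.tsv`; no kit); the digit width `b` is two bits above the size of
the running-sum bound recorded by the scan.  18 characters in this file (est. 78 kernel-s).
NOT covered here (no Fekete–Pólya witness with `w ≤ 40`, `q·w ≤ 4·10⁵`, `K ≤ 12`; the other Fekete–Pólya rows of this range are in the `NoRealZeroFeketePolyaX…` files) — left to the truncation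
certificates of the companion lane: see those files.

## References

* H. L. Montgomery, R. C. Vaughan, *Multiplicative Number Theory I*, CUP 2007, §9.3 Thm 9.13, §11.2.1
  Exercises 7–8. [MontgomeryVaughan2007]
* M. Fekete, G. Pólya, *Über ein Problem von Laguerre*, Rend. Circ. Mat. Palermo 34 (1912) 89–120. [FeketePolya1912]
-/

namespace Literature.NumberTheory.LFunctions

open FeketePolyaKernel

set_option maxHeartbeats 400000 in
/-- `D = 17453`: the even character `(·/17453)` of conductor `17453` (`17453`: 31 · 563) — Fekete–Pólya witness of order `7` along the induced modulus `17453·6 = 104718`, block certificate (digits of `98` bits, splitting depth `9`); est. `3.7` kernel-s. [cite: MontgomeryVaughan2007, §11.2.1 Exercises 7 (g), 8] -/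
theorem noRealZeroEven_fp_17453 :
    ∀ χ : DirichletCharacter ℂ 17453, χ.IsQuadratic → χ.IsPrimitive → χ.Even →
      ∀ σ : ℝ, 0 < σ → σ < 1 → χ.LFunction σ ≠ 0 :=
  good_even_of_odd_blk [31, 563] (by norm_num) (by decide) (by decide) 6 7 98 9 (by decide) (by decide) (by decide)
    (Or.inr (by decide +kernel))

set_option maxHeartbeats 400000 in
/-- `D = -17563`: the odd character `(·/17563)` of conductor `17563` (`17563`: 7 · 13 · 193) — Fekete–Pólya witness of order `6` along the induced modulus `17563·10 = 175630`, block certificate (digits of `89` bits, splitting depth `10`); est. `5.2` kernel-s. [cite: MontgomeryVaughan2007, §11.2.1 Exercises 7 (g), 8] -/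
theorem noRealZeroOdd_fp_17563 :
    ∀ χ : DirichletCharacter ℂ 17563, χ.IsQuadratic → χ.IsPrimitive → χ.Odd →
      ∀ σ : ℝ, 0 < σ → σ < 1 → χ.LFunction σ ≠ 0 :=
  good_odd_of_odd_blk [7, 13, 193] (by norm_num) (by decide) (by decide) 10 6 89 10 (by decide) (by decide) (by decide)
    (Or.inr (by decide +kernel))

set_option maxHeartbeats 400000 in
/-- `D = -17571`: the odd character `(·/17571)` of conductor `17571` (`17571`: 3 · 5857) — Fekete–Pólya witness of order `8` along the induced modulus `17571·7 = 122997`, block certificate (digits of `114` bits, splitting depth `9`); est. `5.6` kernel-s. [cite: MontgomeryVaughan2007, §11.2.1 Exercises 7 (g), 8] -/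
theorem noRealZeroOdd_fp_17571 :
    ∀ χ : DirichletCharacter ℂ 17571, χ.IsQuadratic → χ.IsPrimitive → χ.Odd →
      ∀ σ : ℝ, 0 < σ → σ < 1 → χ.LFunction σ ≠ 0 :=
  good_odd_of_odd_blk [3, 5857] (by norm_num) (by decide) (by decide) 7 8 114 9 (by decide) (by decide) (by decide)
    (Or.inr (by decide +kernel))

set_option maxHeartbeats 400000 in
/-- `D = -17608`: the odd character `χ₋₈·(·/2201)` of conductor `17608` (`2201`: 31 · 71) — Fekete–Pólya witness of order `4` along the induced modulus `17608·15 = 264120`, block certificate (digits of `61` bits, splitting depth `10`); est. `3.6` kernel-s. [cite: MontgomeryVaughan2007, §11.2.1 Exercises 7 (g), 8] -/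
theorem noRealZeroOdd_fp_17608 :
    ∀ χ : DirichletCharacter ℂ 17608, χ.IsQuadratic → χ.IsPrimitive → χ.Odd →
      ∀ σ : ℝ, 0 < σ → σ < 1 → χ.LFunction σ ≠ 0 :=
  good_odd_of_eight_blk [31, 71] (by norm_num) (by decide) (by decide) 15 4 61 10 (by decide) (by decide) (by decide)
    (Or.inr (by decide +kernel)) (Or.inl (by decide +kernel))

set_option maxHeartbeats 400000 in
/-- `D = 17617`: the even character `(·/17617)` of conductor `17617` (`17617`: 79 · 223) — Fekete–Pólya witness of order `8` along the induced modulus `17617·11 = 193787`, block certificate (digits of `119` bits, splitting depth `10`); est. `8.5` kernel-s. [cite: MontgomeryVaughan2007, §11.2.1 Exercises 7 (g), 8] -/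
theorem noRealZeroEven_fp_17617 :
    ∀ χ : DirichletCharacter ℂ 17617, χ.IsQuadratic → χ.IsPrimitive → χ.Even →
      ∀ σ : ℝ, 0 < σ → σ < 1 → χ.LFunction σ ≠ 0 :=
  good_even_of_odd_blk [79, 223] (by norm_num) (by decide) (by decide) 11 8 119 10 (by decide) (by decide) (by decide)
    (Or.inr (by decide +kernel))

set_option maxHeartbeats 400000 in
/-- `D = -17623`: the odd character `(·/17623)` of conductor `17623` (`17623`: prime) — Fekete–Pólya witness of order `5` along the induced modulus `17623·15 = 264345`, block certificate (digits of `77` bits, splitting depth `11`); est. `7.4` kernel-s. [cite: MontgomeryVaughan2007, §11.2.1 Exercises 7 (g), 8] -/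
theorem noRealZeroOdd_fp_17623 :
    ∀ χ : DirichletCharacter ℂ 17623, χ.IsQuadratic → χ.IsPrimitive → χ.Odd →
      ∀ σ : ℝ, 0 < σ → σ < 1 → χ.LFunction σ ≠ 0 :=
  good_odd_of_odd_blk [17623] (by norm_num) (by decide) (by decide) 15 5 77 11 (by decide) (by decide) (by decide)
    (Or.inr (by decide +kernel))

set_option maxHeartbeats 400000 in
/-- `D = -17636`: the odd character `χ₋₄·(·/4409)` of conductor `17636` (`4409`: prime) — Fekete–Pólya witness of order `2` along the induced modulus `17636·11 = 193996`, block certificate (digits of `27` bits, splitting depth `8`); est. `1.2` kernel-s. [cite: MontgomeryVaughan2007, §11.2.1 Exercises 7 (g), 8] -/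
theorem noRealZeroOdd_fp_17636 :
    ∀ χ : DirichletCharacter ℂ 17636, χ.IsQuadratic → χ.IsPrimitive → χ.Odd →
      ∀ σ : ℝ, 0 < σ → σ < 1 → χ.LFunction σ ≠ 0 :=
  good_odd_of_four_blk [4409] (by norm_num) (by decide) (by decide) 11 2 27 8 (by decide) (by decide) (by decide)
    (Or.inr (by decide +kernel))

set_option maxHeartbeats 400000 in
/-- `D = -17683`: the odd character `(·/17683)` of conductor `17683` (`17683`: prime) — Fekete–Pólya witness of order `4` along the induced modulus `17683·15 = 265245`, block certificate (digits of `60` bits, splitting depth `10`); est. `4.6` kernel-s. [cite: MontgomeryVaughan2007, §11.2.1 Exercises 7 (g), 8] -/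
theorem noRealZeroOdd_fp_17683 :
    ∀ χ : DirichletCharacter ℂ 17683, χ.IsQuadratic → χ.IsPrimitive → χ.Odd →
      ∀ σ : ℝ, 0 < σ → σ < 1 → χ.LFunction σ ≠ 0 :=
  good_odd_of_odd_blk [17683] (by norm_num) (by decide) (by decide) 15 4 60 10 (by decide) (by decide) (by decide)
    (Or.inr (by decide +kernel))

set_option maxHeartbeats 400000 in
/-- `D = 17777`: the even character `(·/17777)` of conductor `17777` (`17777`: 29 · 613) — Fekete–Pólya witness of order `8` along the induced modulus `17777·5 = 88885`, block certificate (digits of `111` bits, splitting depth `9`); est. `3.8` kernel-s. [cite: MontgomeryVaughan2007, §11.2.1 Exercises 7 (g), 8] -/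
theorem noRealZeroEven_fp_17777 :
    ∀ χ : DirichletCharacter ℂ 17777, χ.IsQuadratic → χ.IsPrimitive → χ.Even →
      ∀ σ : ℝ, 0 < σ → σ < 1 → χ.LFunction σ ≠ 0 :=
  good_even_of_odd_blk [29, 613] (by norm_num) (by decide) (by decide) 5 8 111 9 (by decide) (by decide) (by decide)
    (Or.inr (by decide +kernel))

set_option maxHeartbeats 400000 in
/-- `D = 17813`: the even character `(·/17813)` of conductor `17813` (`17813`: 47 · 379) — Fekete–Pólya witness of order `4` along the induced modulus `17813·15 = 267195`, block certificate (digits of `58` bits, splitting depth `10`); est. `3.5` kernel-s. [cite: MontgomeryVaughan2007, §11.2.1 Exercises 7 (g), 8] -/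
theorem noRealZeroEven_fp_17813 :
    ∀ χ : DirichletCharacter ℂ 17813, χ.IsQuadratic → χ.IsPrimitive → χ.Even →
      ∀ σ : ℝ, 0 < σ → σ < 1 → χ.LFunction σ ≠ 0 :=
  good_even_of_odd_blk [47, 379] (by norm_num) (by decide) (by decide) 15 4 58 10 (by decide) (by decide) (by decide)
    (Or.inr (by decide +kernel))

set_option maxHeartbeats 400000 in
/-- `D = 17832`: the even character `χ₈·(·/2229)` of conductor `17832` (`2229`: 3 · 743) — Fekete–Pólya witness of order `7` along the induced modulus `17832·5 = 89160`, block certificate (digits of `97` bits, splitting depth `9`); est. `3.2` kernel-s. [cite: MontgomeryVaughan2007, §11.2.1 Exercises 7 (g), 8] -/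
theorem noRealZeroEven_fp_17832 :
    ∀ χ : DirichletCharacter ℂ 17832, χ.IsQuadratic → χ.IsPrimitive → χ.Even →
      ∀ σ : ℝ, 0 < σ → σ < 1 → χ.LFunction σ ≠ 0 :=
  good_even_of_eight_blk [3, 743] (by norm_num) (by decide) (by decide) 5 7 97 9 (by decide) (by decide) (by decide)
    (Or.inl (by decide +kernel)) (Or.inr (by decide +kernel))

set_option maxHeartbeats 400000 in
/-- `D = 17852`: the even character `χ₋₄·(·/4463)` of conductor `17852` (`4463`: prime) — Fekete–Pólya witness of order `3` along the induced modulus `17852·15 = 267780`, block certificate (digits of `42` bits, splitting depth `10`); est. `2.8` kernel-s. [cite: MontgomeryVaughan2007, §11.2.1 Exercises 7 (g), 8] -/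
theorem noRealZeroEven_fp_17852 :
    ∀ χ : DirichletCharacter ℂ 17852, χ.IsQuadratic → χ.IsPrimitive → χ.Even →
      ∀ σ : ℝ, 0 < σ → σ < 1 → χ.LFunction σ ≠ 0 :=
  good_even_of_four_blk [4463] (by norm_num) (by decide) (by decide) 15 3 42 10 (by decide) (by decide) (by decide)
    (Or.inr (by decide +kernel))

set_option maxHeartbeats 400000 in
/-- `D = -17864`: the odd character `χ₋₈·(·/2233)` of conductor `17864` (`2233`: 7 · 11 · 29) — Fekete–Pólya witness of order `2` along the induced modulus `17864·13 = 232232`, block certificate (digits of `27` bits, splitting depth `8`); est. `1.1` kernel-s. [cite: MontgomeryVaughan2007, §11.2.1 Exercises 7 (g), 8] -/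
theorem noRealZeroOdd_fp_17864 :
    ∀ χ : DirichletCharacter ℂ 17864, χ.IsQuadratic → χ.IsPrimitive → χ.Odd →
      ∀ σ : ℝ, 0 < σ → σ < 1 → χ.LFunction σ ≠ 0 :=
  good_odd_of_eight_blk [7, 11, 29] (by norm_num) (by decide) (by decide) 13 2 27 8 (by decide) (by decide) (by decide)
    (Or.inr (by decide +kernel)) (Or.inl (by decide +kernel))

set_option maxHeartbeats 400000 in
/-- `D = -17903`: the odd character `(·/17903)` of conductor `17903` (`17903`: prime) — Fekete–Pólya witness of order `5` along the induced modulus `17903·5 = 89515`, block certificate (digits of `71` bits, splitting depth `9`); est. `3.3` kernel-s. [cite: MontgomeryVaughan2007, §11.2.1 Exercises 7 (g), 8] -/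
theorem noRealZeroOdd_fp_17903 :
    ∀ χ : DirichletCharacter ℂ 17903, χ.IsQuadratic → χ.IsPrimitive → χ.Odd →
      ∀ σ : ℝ, 0 < σ → σ < 1 → χ.LFunction σ ≠ 0 :=
  good_odd_of_odd_blk [17903] (by norm_num) (by decide) (by decide) 5 5 71 9 (by decide) (by decide) (by decide)
    (Or.inr (by decide +kernel))

set_option maxHeartbeats 400000 in
/-- `D = 17933`: the even character `(·/17933)` of conductor `17933` (`17933`: 79 · 227) — Fekete–Pólya witness of order `7` along the induced modulus `17933·6 = 107598`, block certificate (digits of `99` bits, splitting depth `9`); est. `3.8` kernel-s. [cite: MontgomeryVaughan2007, §11.2.1 Exercises 7 (g), 8] -/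
theorem noRealZeroEven_fp_17933 :
    ∀ χ : DirichletCharacter ℂ 17933, χ.IsQuadratic → χ.IsPrimitive → χ.Even →
      ∀ σ : ℝ, 0 < σ → σ < 1 → χ.LFunction σ ≠ 0 :=
  good_even_of_odd_blk [79, 227] (by norm_num) (by decide) (by decide) 6 7 99 9 (by decide) (by decide) (by decide)
    (Or.inr (by decide +kernel))

set_option maxHeartbeats 400000 in
/-- `D = -17940`: the odd character `χ₋₄·(·/4485)` of conductor `17940` (`4485`: 3 · 5 · 13 · 23) — Fekete–Pólya witness of order `2` along the induced modulus `17940·17 = 304980`, block certificate (digits of `27` bits, splitting depth `9`); est. `1.4` kernel-s. [cite: MontgomeryVaughan2007, §11.2.1 Exercises 7 (g), 8] -/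
theorem noRealZeroOdd_fp_17940 :
    ∀ χ : DirichletCharacter ℂ 17940, χ.IsQuadratic → χ.IsPrimitive → χ.Odd →
      ∀ σ : ℝ, 0 < σ → σ < 1 → χ.LFunction σ ≠ 0 :=
  good_odd_of_four_blk [3, 5, 13, 23] (by norm_num) (by decide) (by decide) 17 2 27 9 (by decide) (by decide) (by decide)
    (Or.inr (by decide +kernel))

set_option maxHeartbeats 400000 in
/-- `D = 18088`: the even character `χ₈·(·/2261)` of conductor `18088` (`2261`: 7 · 17 · 19) — Fekete–Pólya witness of order `8` along the induced modulus `18088·13 = 235144`, block certificate (digits of `120` bits, splitting depth `10`); est. `10.4` kernel-s. [cite: MontgomeryVaughan2007, §11.2.1 Exercises 7 (g), 8] -/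
theorem noRealZeroEven_fp_18088 :
    ∀ χ : DirichletCharacter ℂ 18088, χ.IsQuadratic → χ.IsPrimitive → χ.Even →
      ∀ σ : ℝ, 0 < σ → σ < 1 → χ.LFunction σ ≠ 0 :=
  good_even_of_eight_blk [7, 17, 19] (by norm_num) (by decide) (by decide) 13 8 120 10 (by decide) (by decide) (by decide)
    (Or.inl (by decide +kernel)) (Or.inr (by decide +kernel))

set_option maxHeartbeats 400000 in
/-- `D = -18115`: the odd character `(·/18115)` of conductor `18115` (`18115`: 5 · 3623) — Fekete–Pólya witness of order `4` along the induced modulus `18115·22 = 398530`, block certificate (digits of `62` bits, splitting depth `10`); est. `5.6` kernel-s. [cite: MontgomeryVaughan2007, §11.2.1 Exercises 7 (g), 8] -/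
theorem noRealZeroOdd_fp_18115 :
    ∀ χ : DirichletCharacter ℂ 18115, χ.IsQuadratic → χ.IsPrimitive → χ.Odd →
      ∀ σ : ℝ, 0 < σ → σ < 1 → χ.LFunction σ ≠ 0 :=
  good_odd_of_odd_blk [5, 3623] (by norm_num) (by decide) (by decide) 22 4 62 10 (by decide) (by decide) (by decide)
    (Or.inr (by decide +kernel))

end Literature.NumberTheory.LFunctions
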